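import Summits.CriticalPhenomena.PercolationContinuityZ3.Theorems.SahiMasterFamilyGHConjecture
import Literature.Probability.LatticeModels.ProdBernoulliIndependence

/-!
# The G-system of a principal-cap family: `(GH)_k ⇒ PC-k` (Sahi's `C_k` on the principal-cap stratum), every `k`

Unit `prim-masterthm-p4` (gen 16; crux anchor stmt-CriticalPhenomena-4575, helper work; memo
`run/shared/lean/prim/prim-masterthm/prim-masterthm-p4/P4-GEN16-REPORT.md` §2).  Companion of `…GHConjecture` (`GSystemNonneg k` = (GH)_k,
`UCHullNonneg k`), `…PrincipalCapBeta` (cores `K_j`, conditional moments `β_B = μ(U_B)/P_B`, β-normal form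
`E_{k+1} = (∏ P_j)·Φ_{k+1}(β)`) and gen 15's realizability note (P4-GEN15-REPORT §2(a), PROOF-GEN15.md Thm 2, item (R1)).

* `PCNonneg k` — **PC-k** typed: Sahi's `E_k(μ_p; 1_{U_0},…,1_{U_{k-1}}) ≥ 0` for every finite product space `μ_p` and every
  family of increasing events whose common part `⋂_j U_j` is a PRINCIPAL up-set `{T | c ⊆ T}`.  A conjecture-valued definition
  (OPEN for `k ≥ 8`; the tree has it for `k ≤ 7`, `…PrincipalCapLeSix`/`…PhiOrbitSeven`).
* `gsys U K S := {ω | ω ∪ K_S ∈ ⋂_{j∈S} U_j}` (`K_S = ⋃_{j∈S} K_j`) — **the G-system of a principal-cap family**: increasing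
  (`isUpperSet_gsys`), sub-intersective `G_S ∩ G_T ⊆ G_{S∪T}` (`gsys_inter_subset`), normalised `G_univ = univ` (`gsys_univ`), and
  **`β_S = μ_p(G_S)`** whenever `P_S ≠ 0` (`beta_eq_ex_gsys`; Fubini on the product space: `⋂_{j∈S} U_j = [K_S] ∩ G_S` with the
  two factors determined by the disjoint coordinate sets `K_S`, `K_Sᶜ` — `biInter_eq_cyl_inter_gsys`, `mom_eq_coreP_mul_ex_gsys`).
* **`pcNonneg_of_gSystemNonneg : GSystemNonneg k → PCNonneg k`** (every `k`), hence
  **`pcNonneg_of_ucHullNonneg : UCHullNonneg k → PCNonneg k`** and `pcNonneg_four'` (from `…UCHullFour` one would get PC-4 again;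
  here from `(GH)_4`).  So any future proof of `(UC-hull)_k` or `(GH)_k` is, in the kernel, a proof of Sahi's `C_k` on the
  principal-cap stratum.  (The converse realizability `PC-k ⇒ (GH)_k`, an `η → 0` limit of cored families, is paper-only: memo §2.)
HONEST FRAMING: nothing here asserts PC-k; `(GH)_k`, PC-k (k ≥ 8), Sahi's `C_k`, Kahn's Conjecture 5 and the master theorem remain OPEN.
Axioms standard. [this work]
-/

noncomputable section

open scoped Classical

namespace Summit.CriticalPhenomena.PercolationContinuityZ3.Theorems

namespace GHBridge

open Finset
open Literature.Combinatorics.Sahi2008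
open Literature.Probability.LatticeModels (prodBernoulli prodBernoulli_real_inter_of_determinedBy_disjoint)
open Literature.Probability.Percolation (DeterminedBy determinedBy_iff)
open Literature.Probability.Percolation.DecisionTree (ind ind_of_mem ind_of_not_mem ind_nonneg)
open PrincipalCapBeta (phiSet cyl coreP mom beta)

/-- **PC-k** — Sahi's `k`-th inequality on the principal-cap stratum of product measures: for every finite product of two-point
spaces and every `k` increasing events whose common part is a principal up-set, `E_k(μ_p; 1_{U_0},…,1_{U_{k−1}}) ≥ 0`.
A conjecture-valued definition, never a fact. [this work] [status: open for k ≥ 8; true for k ≤ 7] -/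
@[conjecture] def PCNonneg (k : ℕ) : Prop :=
  ∀ (ι : Type) [Fintype ι] (p : ι → unitInterval) (U : Fin k → Set (Set ι)),
    (∀ j, IsUpperSet (U j)) → ∀ c : Finset ι, (∀ T : Set ι, (∀ j, T ∈ U j) ↔ (↑c : Set ι) ⊆ T) →
      0 ≤ sahiE (bernoulliWeight p) k (fun j => ind (U j))

variable {ι : Type} [Fintype ι] {k : ℕ}

/-- **The G-system of a cored family**: `G_S = {ω | ω ∪ K_S ∈ ⋂_{j∈S} U_j}`, `K_S = ⋃_{j∈S} K_j` ("force the cores of `S` open,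
then ask for the events of `S`"). [this work] -/
def gsys (U : Fin k → Set (Set ι)) (K : Fin k → Finset ι) (S : Finset (Fin k)) : Set (Set ι) :=
  {ω | ω ∪ ↑(S.biUnion K) ∈ ⋂ j ∈ S, U j}

omit [Fintype ι] in
/-- Membership in `gsys`. [this work] -/
theorem mem_gsys {U : Fin k → Set (Set ι)} {K : Fin k → Finset ι} {S : Finset (Fin k)} {ω : Set ι} :
    ω ∈ gsys U K S ↔ ∀ j ∈ S, ω ∪ ↑(S.biUnion K) ∈ U j := by
  unfold gsys
  rw [Set.mem_setOf_eq, Set.mem_iInter₂]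

omit [Fintype ι] in
/-- `G_S` is increasing. [this work] -/
theorem isUpperSet_gsys {U : Fin k → Set (Set ι)} (hU : ∀ j, IsUpperSet (U j)) (K : Fin k → Finset ι)
    (S : Finset (Fin k)) : IsUpperSet (gsys U K S) := by
  intro ω ω' hle hω
  rw [mem_gsys] at hω ⊢
  exact fun j hj => hU j (Set.union_subset_union_left _ hle) (hω j hj)

omit [Fintype ι] in
/-- **Sub-intersectivity** `G_S ∩ G_T ⊆ G_{S∪T}` (the cores of `S ∪ T` contain those of `S`). [this work] -/
theorem gsys_inter_subset {U : Fin k → Set (Set ι)} (hU : ∀ j, IsUpperSet (U j)) (K : Fin k → Finset ι)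
    (S T : Finset (Fin k)) : gsys U K S ∩ gsys U K T ⊆ gsys U K (S ∪ T) := by
  rintro ω ⟨hS, hT⟩
  rw [mem_gsys] at hS hT ⊢
  intro j hj
  have hKS : (↑(S.biUnion K) : Set ι) ⊆ ↑((S ∪ T).biUnion K) :=
    coe_subset.2 (biUnion_subset_biUnion_of_subset_left K subset_union_left)
  have hKT : (↑(T.biUnion K) : Set ι) ⊆ ↑((S ∪ T).biUnion K) :=
    coe_subset.2 (biUnion_subset_biUnion_of_subset_left K subset_union_right)
  rcases mem_union.1 hj with hjS | hjT
  · exact hU j (Set.union_subset_union_right ω hKS) (hS j hjS)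
  · exact hU j (Set.union_subset_union_right ω hKT) (hT j hjT)

omit [Fintype ι] in
/-- **Normalisation** `G_univ = univ` when the cylinder on all cores lies in every event. [this work] -/
theorem gsys_univ {U : Fin k → Set (Set ι)} {K : Fin k → Finset ι}
    (hcap : cyl (univ.biUnion K) ⊆ ⋂ j ∈ (univ : Finset (Fin k)), U j) : gsys U K univ = Set.univ := by
  refine Set.eq_univ_of_forall fun ω => ?_
  unfold gsys
  rw [Set.mem_setOf_eq]
  exact hcap (Set.subset_union_right)

omit [Fintype ι] in
/-- `⋂_{j∈S} U_j = [K_S] ∩ G_S` for events living inside the cylinders on their cores. [this work] -/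
theorem biInter_eq_cyl_inter_gsys {U : Fin k → Set (Set ι)} {K : Fin k → Finset ι} (hsub : ∀ j, U j ⊆ cyl (K j))
    (S : Finset (Fin k)) : (⋂ j ∈ S, U j) = cyl (S.biUnion K) ∩ gsys U K S := by
  ext ω
  rw [Set.mem_iInter₂, Set.mem_inter_iff, mem_gsys, PrincipalCapBeta.mem_cyl]
  constructor
  · intro h
    have hK : (↑(S.biUnion K) : Set ι) ⊆ ω := by
      intro e he
      obtain ⟨j, hj, hje⟩ := mem_biUnion.1 (mem_coe.1 he)
      exact hsub j (h j hj) (mem_coe.2 hje)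
    refine ⟨hK, fun j hj => ?_⟩
    rw [Set.union_eq_self_of_subset_right hK]
    exact h j hj
  · rintro ⟨hK, h⟩ j hj
    have := h j hj
    rwa [Set.union_eq_self_of_subset_right hK] at this

omit [Fintype ι] in
/-- A cylinder `[F]` is determined by the coordinates in `F`. [folklore] -/
theorem determinedBy_cyl (F : Finset ι) : DeterminedBy (cyl F) (↑F : Set ι) := by
  rw [determinedBy_iff]
  intro ω ω' h
  rw [PrincipalCapBeta.mem_cyl, PrincipalCapBeta.mem_cyl]
  constructor
  · intro hω e he
    have : e ∈ ω ∩ ↑F := ⟨hω he, he⟩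
    rw [h] at this
    exact this.1
  · intro hω e he
    have : e ∈ ω' ∩ ↑F := ⟨hω he, he⟩
    rw [← h] at this
    exact this.1

omit [Fintype ι] in
/-- `ω ∪ F` only depends on `ω` off `F`. [folklore] -/
theorem union_eq_of_inter_compl_eq {F : Set ι} {ω ω' : Set ι} (h : ω ∩ Fᶜ = ω' ∩ Fᶜ) : ω ∪ F = ω' ∪ F := by
  ext x
  by_cases hx : x ∈ F
  · simp only [Set.mem_union, hx, or_true]
  · have hiff := Set.ext_iff.1 h x
    simp only [Set.mem_inter_iff, Set.mem_compl_iff, hx, not_false_eq_true, and_true] at hiff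
    simp only [Set.mem_union, hx, or_false, hiff]

/-- `G_S` is determined by the coordinates OFF the cores of `S`. [this work] -/
theorem determinedBy_gsys (U : Fin k → Set (Set ι)) (K : Fin k → Finset ι) (S : Finset (Fin k)) :
    DeterminedBy (gsys U K S) (↑(univ \ S.biUnion K) : Set ι) := by
  rw [determinedBy_iff]
  intro ω ω' h
  have hc : (↑(univ \ S.biUnion K) : Set ι) = (↑(S.biUnion K) : Set ι)ᶜ := by
    rw [coe_sdiff, coe_univ, Set.compl_eq_univ_sdiff]
  rw [hc] at h
  unfold gsys
  rw [Set.mem_setOf_eq, Set.mem_setOf_eq, union_eq_of_inter_compl_eq h]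

/-- **Fubini for the cored family**: `μ_p(⋂_{j∈S} U_j) = P_S · μ_p(G_S)` (`P_S = ∏_{j∈S} ∏_{e∈K_j} p_e`). [this work] -/
theorem mom_eq_coreP_mul_ex_gsys (p : ι → unitInterval) {U : Fin k → Set (Set ι)} {K : Fin k → Finset ι}
    (hdisj : ∀ i j, i ≠ j → Disjoint (K i) (K j)) (hsub : ∀ j, U j ⊆ cyl (K j)) (S : Finset (Fin k)) :
    mom p U S = (∏ j ∈ S, coreP p K j) * ex (bernoulliWeight p) (ind (gsys U K S)) := by
  unfold mom
  rw [biInter_eq_cyl_inter_gsys hsub S, ex_bernoulliWeight_ind, ex_bernoulliWeight_ind,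
    ← PrincipalCapBeta.prod_biUnion_coreP p hdisj S, ← PrincipalCapBeta.ex_ind_cyl, ex_bernoulliWeight_ind]
  have hA := determinedBy_cyl (S.biUnion K)
  have hB := determinedBy_gsys U K S
  exact prodBernoulli_real_inter_of_determinedBy_disjoint p disjoint_sdiff hA hB hA.measurableSet_of_finset
    hB.measurableSet_of_finset

/-- **`β_S = μ_p(G_S)`** whenever `P_S ≠ 0`: the conditional moments of a principal-cap family ARE the moments of its G-system. [this work] -/
theorem beta_eq_ex_gsys (p : ι → unitInterval) {U : Fin k → Set (Set ι)} {K : Fin k → Finset ι}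
    (hdisj : ∀ i j, i ≠ j → Disjoint (K i) (K j)) (hsub : ∀ j, U j ⊆ cyl (K j)) (S : Finset (Fin k))
    (hP : ∏ j ∈ S, coreP p K j ≠ 0) : beta p U K S = ex (bernoulliWeight p) (ind (gsys U K S)) := by
  unfold beta
  rw [mom_eq_coreP_mul_ex_gsys p hdisj hsub S, mul_div_cancel_left₀ _ hP]

/-- **`(GH)_k ⇒ PC-k`, every `k`.**  If Sahi's formal functional is nonnegative on the moments of every normalised G-system on every
finite product space, then Sahi's `E_k ≥ 0` for every principal-cap family of `k` increasing events under every product measure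
(β-normal form `E_k = (∏_j P_j)·Φ_k(β)` and `β = μ(G_·)`; when some `P_j = 0` the functional vanishes). [this work] -/
theorem pcNonneg_of_gSystemNonneg (h : GHConjecture.GSystemNonneg k) : PCNonneg k := by
  intro ι _ p U hU c hpc
  cases k with
  | zero => rw [sahiE_zero]
  | succ k =>
    obtain ⟨K, hdisj, hsub, hcap⟩ := PrincipalCapBeta.cores_of_principalCap hU c hpc
    rw [PrincipalCapBeta.sahiE_ind_eq_mul_phiSet p U K hdisj hsub]
    by_cases hP : ∏ j, coreP p K j = 0
    · rw [hP, zero_mul]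
    · refine mul_nonneg (prod_nonneg fun j _ => PrincipalCapBeta.coreP_nonneg p K j) ?_
      have hPS : ∀ S : Finset (Fin (k + 1)), ∏ j ∈ S, coreP p K j ≠ 0 := by
        intro S hS
        obtain ⟨j, _, hj⟩ := prod_eq_zero_iff.1 hS
        exact hP (prod_eq_zero_iff.2 ⟨j, mem_univ j, hj⟩)
      have hβ : beta p U K = fun S => ex (bernoulliWeight p) (ind (gsys U K S)) :=
        funext fun S => beta_eq_ex_gsys p hdisj hsub S (hPS S)
      rw [hβ]
      exact h ι p (gsys U K) (isUpperSet_gsys hU K) (gsys_inter_subset hU K) (gsys_univ hcap)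

/-- **`(UC-hull)_k ⇒ PC-k`**, every `k`. [this work] -/
theorem pcNonneg_of_ucHullNonneg (h : GHConjecture.UCHullNonneg k) : PCNonneg k :=
  pcNonneg_of_gSystemNonneg (GHConjecture.gSystemNonneg_of_ucHullNonneg h)

/-- PC-k for every `3 ≤ k ≤ 7`, read through the bridge from `(GH)_k` (`GHConjecture.gSystemNonneg_of_le_seven`). [this work] -/
theorem pcNonneg_of_le_seven (h3 : 3 ≤ k) (h7 : k ≤ 7) : PCNonneg k :=
  pcNonneg_of_gSystemNonneg (GHConjecture.gSystemNonneg_of_le_seven h3 h7)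

end GHBridge

end Summit.CriticalPhenomena.PercolationContinuityZ3.Theorems
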